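import Mathlib
import HarnessLib
import Literature.MathematicalPhysics.StatisticalMechanics.ReblockingNeighbourhoods
import Literature.MathematicalPhysics.StatisticalMechanics.TorusPolymerBridge

/-!
# The decomposition `X = X₁ ⊔ X₂` of a polymer attributed to a strictly disjoint union
# `π(X) = U₁ ∪ U₂` ([ABKM19] proof of Lemma 6.4 (5))

In the proof that the renormalised perturbation `K_{k+1}` factors over strictly disjoint
`(k+1)`-polymers, [ABKM19] show: if `U₁, U₂ ∈ 𝓟_{k+1}` are strictly disjoint and `X ∈ 𝓟_k` has
`π(X) = U₁ ∪ U₂`, then `X = X₁ ∪ X₂` with `X_i = X ∩ U_i*` strictly disjoint and `π(X_i) = U_i`,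
and this decomposition is unique.  Here `U* = U + [−r', r']^d` and the separation of `U₁, U₂` is
quantified by `D` (`dist_∞(U₁, U₂) ≥ D`); the facts used are `Y ⊆ π(Y)*` for `k`-polymers
((6.28), `thicken_subset_thicken_reblock`) and that a connected set does not straddle
`2`-separated sets.

* `components_union_of_separated`, `components_biUnion_subset` — components of separated unions
  and of unions of components;
* `reblock_union_of_separated` — `π(X₁ ∪ X₂) = π(X₁) ∪ π(X₂)` for `2`-separated `X₁, X₂` ((6.26));
* `closure_thicken_disjoint` — `closure_{k+1}(U_i*) ∩ U_j = ∅` when `dist(U_i, U_j) > r'`;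
* `piecesOf r' U₁ X = X ∩ U₁*`; **`reblock_piecesOf`** (`π(X ∩ U_i*) = U_i`),
  **`piecesOf_union`** (`X = (X ∩ U₁*) ∪ (X ∩ U₂*)`), `isPolymer_piecesOf`,
  `separated_piecesOf` (`dist(X₁, X₂) ≥ D − 2r'`), and the converse **`reblock_union_eq`**,
  **`piecesOf_union_left/right`** — together: `X ↦ (X ∩ U₁*, X ∩ U₂*)` is a bijection from
  `{X ∈ 𝓟_k : π(X) = U₁ ∪ U₂}` onto `{X₁ : π(X₁) = U₁} × {X₂ : π(X₂) = U₂}` with inverse `∪`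
  (`sum_reblock_eq_union`, the form used to factor the sum (6.34)).

Everything is proved; no named fact.

## References
* S. Adams, S. Buchholz, R. Kotecký, S. Müller, arXiv:1910.13564, proof of Lemma 6.4 (5) (the
  paragraph "we claim that there is a unique decomposition `X = X₁ ∪ X₂`"), (6.26), (6.28)
  [AdamsBuchholzKoteckyMuller2019].
-/

noncomputable section

namespace Literature.MathematicalPhysics.StatisticalMechanics.TorusPolymer

open scoped BigOperators Classical
open Finset
open Literature.Barriers.CriticalPhenomena.LongRangePhi4.Polymer
  (AdjInf ConnIn IsConn comp components mem_comp comp_subset mem_comp_self isConn_comp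
    comp_eq_of_mem eq_biUnion_components)

variable {d M : ℕ} [NeZero M]

/-! ## Components of separated unions -/

omit [NeZero M] in
/-- `ConnIn` is monotone in the ambient set (re-export for dot-free use). [folklore] -/
private theorem connIn_mono {X X' : Finset (Fin d → ZMod M)} (h : X ⊆ X') {x y : Fin d → ZMod M}
    (hxy : ConnIn X x y) : ConnIn X' x y := hxy.mono h

/-- The component of a point of `A` in a `2`-separated union `A ∪ B` is its component in `A`.
[cite: AdamsBuchholzKoteckyMuller2019, Lemma 6.4 (5) (proof)] -/
theorem comp_union_of_separated {A B : Finset (Fin d → ZMod M)} (hAB : Separated 2 A B)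
    {x : Fin d → ZMod M} (hx : x ∈ A) : comp (A ∪ B) x = comp A x := by
  apply Subset.antisymm
  · -- `comp (A ∪ B) x` is connected, inside `A ∪ B`, contains `x ∈ A`: it lies inside `A`
    have hconn : IsConn (comp (A ∪ B) x) := isConn_comp (mem_union_left B hx)
    have hsub : comp (A ∪ B) x ⊆ A := by
      rcases subset_or_subset_of_isConn hconn (comp_subset _ x) hAB with h | h
      · exact h
      · exfalso
        have hxB := h (mem_comp_self (mem_union_left B hx))
        have := hAB x hx x hxB
        rw [sub_self] at this
        simp [GradientFRD.supNorm, ZMod.valMinAbs_zero] at this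
    intro y hy
    have hconn_xy := hconn.2 x (mem_comp_self (mem_union_left B hx)) y hy
    exact mem_comp.2 ⟨hsub hy, connIn_mono hsub hconn_xy⟩
  · intro y hy
    obtain ⟨hyA, hxy⟩ := mem_comp.1 hy
    exact mem_comp.2 ⟨mem_union_left B hyA, connIn_mono subset_union_left hxy⟩

/-- **Components of a `2`-separated union**: `𝓒(A ∪ B) = 𝓒(A) ∪ 𝓒(B)`.
[cite: AdamsBuchholzKoteckyMuller2019, Lemma 6.4 (5) (proof)] -/
theorem components_union_of_separated {A B : Finset (Fin d → ZMod M)} (hAB : Separated 2 A B) :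
    components (A ∪ B) = components A ∪ components B := by
  ext Y
  constructor
  · intro hY
    obtain ⟨x, hx, rfl⟩ := mem_image.1 hY
    rcases mem_union.1 hx with h | h
    · exact mem_union_left _ (mem_image.2 ⟨x, h, (comp_union_of_separated hAB h).symm⟩)
    · refine mem_union_right _ (mem_image.2 ⟨x, h, ?_⟩)
      rw [union_comm, comp_union_of_separated hAB.symm h]
  · intro hY
    rcases mem_union.1 hY with hY | hY
    · obtain ⟨x, hx, rfl⟩ := mem_image.1 hY
      exact mem_image.2 ⟨x, mem_union_left B hx, comp_union_of_separated hAB hx⟩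
    · obtain ⟨x, hx, rfl⟩ := mem_image.1 hY
      refine mem_image.2 ⟨x, mem_union_right A hx, ?_⟩
      rw [union_comm, comp_union_of_separated hAB.symm hx]

/-- **`π(X₁ ∪ X₂) = π(X₁) ∪ π(X₂)`** for `2`-separated `X₁, X₂` ((6.26)).
[cite: AdamsBuchholzKoteckyMuller2019, Ch. 6.3 (6.26)] -/
theorem reblock_union_of_separated (s s' : ℕ) {X₁ X₂ : Finset (Fin d → ZMod M)}
    (h : Separated 2 X₁ X₂) : reblock s s' (X₁ ∪ X₂) = reblock s s' X₁ ∪ reblock s s' X₂ := by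
  rw [reblock, components_union_of_separated h, Finset.union_biUnion, ← reblock, ← reblock]

omit [NeZero M] in
/-- The components of a union of some components of `X` are those components.
[cite: AdamsBuchholzKoteckyMuller2019, Lemma 6.4 (5) (proof)] -/
theorem comp_biUnion_components {X : Finset (Fin d → ZMod M)} {𝒮 : Finset (Finset (Fin d → ZMod M))}
    (h𝒮 : 𝒮 ⊆ components X) {Y : Finset (Fin d → ZMod M)} (hY : Y ∈ 𝒮) {y : Fin d → ZMod M}
    (hy : y ∈ Y) : comp (𝒮.biUnion id) y = Y := by
  obtain ⟨x, hx, rfl⟩ := mem_image.1 (h𝒮 hY)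
  have hsub : 𝒮.biUnion id ⊆ X := by
    intro z hz
    obtain ⟨Z, hZ, hzZ⟩ := mem_biUnion.1 hz
    obtain ⟨x', _, rfl⟩ := mem_image.1 (h𝒮 hZ)
    exact comp_subset X x' hzZ
  have hcy : comp X y = comp X x := comp_eq_of_mem hy
  apply Subset.antisymm
  · intro z hz
    obtain ⟨hz1, hyz⟩ := mem_comp.1 hz
    have : z ∈ comp X y := mem_comp.2 ⟨hsub hz1, connIn_mono hsub hyz⟩
    rwa [hcy] at this
  · intro z hz
    have hconn := (isConn_comp hx).2 y hy z hz
    exact mem_comp.2 ⟨mem_biUnion.2 ⟨_, hY, hz⟩, connIn_mono (subset_biUnion_of_mem id hY) hconn⟩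

omit [NeZero M] in
/-- **`𝓒(⋃ 𝒮) = 𝒮`** for a subfamily `𝒮 ⊆ 𝓒(X)`. [cite: AdamsBuchholzKoteckyMuller2019, Lemma 6.4 (5) (proof)] -/
theorem components_biUnion_subset {X : Finset (Fin d → ZMod M)} {𝒮 : Finset (Finset (Fin d → ZMod M))}
    (h𝒮 : 𝒮 ⊆ components X) : components (𝒮.biUnion id) = 𝒮 := by
  ext Y
  rw [components, mem_image]
  constructor
  · rintro ⟨y, hy, rfl⟩
    obtain ⟨Z, hZ, hyZ⟩ := mem_biUnion.1 hy
    rw [comp_biUnion_components h𝒮 hZ hyZ]; exact hZ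
  · intro hY
    obtain ⟨x, hx, rfl⟩ := mem_image.1 (h𝒮 hY)
    exact ⟨x, mem_biUnion.2 ⟨_, hY, mem_comp_self hx⟩, comp_biUnion_components h𝒮 hY (mem_comp_self hx)⟩

/-! ## The pieces `X ∩ U_i*` -/

/-- **`closure_{k+1}(U*) ∩ V = ∅`** for `(k+1)`-polymers `V` with `dist_∞(U, V) > r'`: a block of `V`
meeting `U + [−r',r']^d` would have a point within `r'` of `U`.
[cite: AdamsBuchholzKoteckyMuller2019, Lemma 6.4 (5) (proof: U₁⁺ ∩ U₂ = ∅)] -/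
theorem closure_thicken_disjoint {s' r' D : ℕ} (hD : r' + 1 ≤ D) {U V : Finset (Fin d → ZMod M)}
    (hV : IsPolymer s' V) (hUV : Separated D U V) : Disjoint (closure s' (thicken r' U)) V := by
  rw [Finset.disjoint_left]
  intro y hy hyV
  obtain ⟨z, hz, hzy⟩ := mem_closure.1 hy
  obtain ⟨u, hu, hzu⟩ := mem_thicken.1 hz
  have hzV : z ∈ V := hV y hyV (mem_blockOf.2 hzy.symm)
  have := hUV u hu z hzV
  rw [supNorm_sub_comm] at this
  omega

/-- The piece of `X` attributed to `U`: `X ∩ U*`, `U* = U + [−r',r']^d`.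
[cite: AdamsBuchholzKoteckyMuller2019, Lemma 6.4 (5) (proof: X₁ = U₁* ∩ X)] -/
def piecesOf (r' : ℕ) (U X : Finset (Fin d → ZMod M)) : Finset (Fin d → ZMod M) := X ∩ thicken r' U

/-- `X ∩ U* ⊆ X`. [cite: AdamsBuchholzKoteckyMuller2019, Lemma 6.4 (5)] -/
theorem piecesOf_subset (r' : ℕ) (U X : Finset (Fin d → ZMod M)) : piecesOf r' U X ⊆ X := inter_subset_left

/-- `X ∩ U* ⊆ U*`. [cite: AdamsBuchholzKoteckyMuller2019, Lemma 6.4 (5)] -/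
theorem piecesOf_subset_thicken (r' : ℕ) (U X : Finset (Fin d → ZMod M)) :
    piecesOf r' U X ⊆ thicken r' U := inter_subset_right

section Decomposition

variable {s t L r r' D : ℕ} {U₁ U₂ : Finset (Fin d → ZMod M)}

/-- The two thickened regions are `2`-separated. [cite: AdamsBuchholzKoteckyMuller2019, (6.21)] -/
theorem separated_thicken_of_separated (hD : 2 * r' + 2 ≤ D) (hsep : Separated D U₁ U₂) :
    Separated 2 (thicken r' U₁) (thicken r' U₂) :=
  Separated.thicken (hsep.of_le (by omega))

/-- **Each component of `X` with `π(X) ⊆ U₁ ∪ U₂` lies in `U₁*` or in `U₂*`** (it lies in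
`π(Y)* ⊆ π(X)* = U₁* ∪ U₂*` and is connected). [cite: AdamsBuchholzKoteckyMuller2019, Lemma 6.4 (5) (proof)] -/
theorem component_subset_or (hMst : M = s * t) (hs : Odd s) (ht : Odd t) (hL : Odd L)
    (hrr : r ≤ r') (hr : r + (2 ^ d - 1) * s ≤ r') (hD : 2 * r' + 2 ≤ D) (hsep : Separated D U₁ U₂)
    {X Y : Finset (Fin d → ZMod M)}
    (hπ : reblock s (L * s) X ⊆ U₁ ∪ U₂) (hY : Y ∈ components X) :
    Y ⊆ thicken r' U₁ ∨ Y ⊆ thicken r' U₂ := by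
  obtain ⟨x, hx, rfl⟩ := mem_image.1 hY
  have hMo : Odd M := by rw [hMst]; exact hs.mul ht
  have h1 : comp X x ⊆ thicken r' (reblock s (L * s) (comp X x)) :=
    (subset_thicken r _).trans (thicken_subset_thicken_reblock hMst hs ht hL hrr hr (comp X x))
  have h2 : reblock s (L * s) (comp X x) ⊆ U₁ ∪ U₂ := by
    refine Subset.trans ?_ hπ
    rw [reblock_eq_biUnion_components s (L * s) X]
    exact subset_biUnion_of_mem _ hY
  have h3 : comp X x ⊆ thicken r' U₁ ∪ thicken r' U₂ := by
    rw [← thicken_union]; exact h1.trans (thicken_mono r' h2)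
  exact subset_or_subset_of_isConn (isConn_comp hx) h3 (separated_thicken_of_separated hD hsep)

/-- **`X = (X ∩ U₁*) ∪ (X ∩ U₂*)`** when `π(X) ⊆ U₁ ∪ U₂`.
[cite: AdamsBuchholzKoteckyMuller2019, Lemma 6.4 (5) (proof: X ⊂ U₁* ∪ U₂*)] -/
theorem piecesOf_union (hMst : M = s * t) (hs : Odd s) (ht : Odd t) (hL : Odd L)
    (hrr : r ≤ r') (hr : r + (2 ^ d - 1) * s ≤ r') (hD : 2 * r' + 2 ≤ D) (hsep : Separated D U₁ U₂)
    {X : Finset (Fin d → ZMod M)}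
    (hπ : reblock s (L * s) X ⊆ U₁ ∪ U₂) : piecesOf r' U₁ X ∪ piecesOf r' U₂ X = X := by
  apply Subset.antisymm (union_subset (piecesOf_subset _ _ _) (piecesOf_subset _ _ _))
  intro y hy
  have hC : comp X y ∈ components X := mem_image.2 ⟨y, hy, rfl⟩
  rcases component_subset_or hMst hs ht hL hrr hr hD hsep hπ hC with h | h
  · exact mem_union_left _ (mem_inter.2 ⟨hy, h (mem_comp_self hy)⟩)
  · exact mem_union_right _ (mem_inter.2 ⟨hy, h (mem_comp_self hy)⟩)

/-- The pieces are disjoint. [cite: AdamsBuchholzKoteckyMuller2019, Lemma 6.4 (5) (proof)] -/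
theorem disjoint_piecesOf (hD : 2 * r' + 2 ≤ D) (hsep : Separated D U₁ U₂) (X : Finset (Fin d → ZMod M)) :
    Disjoint (piecesOf r' U₁ X) (piecesOf r' U₂ X) := by
  have h := (separated_thicken_of_separated hD hsep).disjoint (by norm_num)
  exact disjoint_of_subset_left (piecesOf_subset_thicken _ _ _)
    (disjoint_of_subset_right (piecesOf_subset_thicken _ _ _) h)

/-- The pieces are `(D − 2r')`-separated. [cite: AdamsBuchholzKoteckyMuller2019, Lemma 6.4 (5) (proof, (6.37))] -/
theorem separated_piecesOf (hsep : Separated D U₁ U₂) (X₁ X₂ : Finset (Fin d → ZMod M)) :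
    Separated (D - 2 * r') (piecesOf r' U₁ X₁) (piecesOf r' U₂ X₂) := by
  by_cases h2 : 2 * r' ≤ D
  · have h : Separated (D - 2 * r') (thicken r' U₁) (thicken r' U₂) :=
      Separated.thicken (hsep.of_le (by omega))
    exact h.mono (piecesOf_subset_thicken _ _ _) (piecesOf_subset_thicken _ _ _)
  · have h0 : D - 2 * r' = 0 := by omega
    rw [h0]
    exact fun _ _ _ _ => Nat.zero_le _

/-- **The piece `X ∩ U_1*` is a union of components of `X`**, namely of those inside `U₁*`.
[cite: AdamsBuchholzKoteckyMuller2019, Lemma 6.4 (5) (proof)] -/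
theorem piecesOf_eq_biUnion (hMst : M = s * t) (hs : Odd s) (ht : Odd t) (hL : Odd L)
    (hrr : r ≤ r') (hr : r + (2 ^ d - 1) * s ≤ r') (hD : 2 * r' + 2 ≤ D) (hsep : Separated D U₁ U₂)
    {X : Finset (Fin d → ZMod M)} (hπ : reblock s (L * s) X ⊆ U₁ ∪ U₂) :
    piecesOf r' U₁ X = ((components X).filter fun Y => Y ⊆ thicken r' U₁).biUnion id := by
  ext y
  rw [piecesOf, mem_inter, mem_biUnion]
  constructor
  · rintro ⟨hyX, hyU⟩
    have hC : comp X y ∈ components X := mem_image.2 ⟨y, hyX, rfl⟩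
    refine ⟨comp X y, mem_filter.2 ⟨hC, ?_⟩, mem_comp_self hyX⟩
    rcases component_subset_or hMst hs ht hL hrr hr hD hsep hπ hC with h | h
    · exact h
    · exfalso
      have hdis := (separated_thicken_of_separated hD hsep).disjoint (by norm_num)
      exact Finset.disjoint_left.1 hdis hyU (h (mem_comp_self hyX))
  · rintro ⟨Y, hY, hyY⟩
    obtain ⟨hYc, hYU⟩ := mem_filter.1 hY
    obtain ⟨x, hx, rfl⟩ := mem_image.1 hYc
    exact ⟨comp_subset X x hyY, hYU hyY⟩

/-- The pieces are `k`-polymers (odd torus). [cite: AdamsBuchholzKoteckyMuller2019, Lemma 6.4 (5) (proof)] -/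
theorem isPolymer_piecesOf (hMst : M = s * t) (hs : Odd s) (ht : Odd t) (hL : Odd L)
    (hrr : r ≤ r') (hr : r + (2 ^ d - 1) * s ≤ r') (hD : 2 * r' + 2 ≤ D) (hsep : Separated D U₁ U₂)
    {X : Finset (Fin d → ZMod M)} (hX : IsPolymer s X)
    (hπ : reblock s (L * s) X ⊆ U₁ ∪ U₂) : IsPolymer s (piecesOf r' U₁ X) := by
  have hMo : Odd M := by rw [hMst]; exact hs.mul ht
  rw [piecesOf_eq_biUnion hMst hs ht hL hrr hr hD hsep hπ]
  intro y hy
  obtain ⟨Y, hY, hyY⟩ := mem_biUnion.1 hy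
  have hYp : IsPolymer s Y := (hX.of_mem_components hMo hs (mem_filter.1 hY).1).1
  exact (hYp y hyY).trans (subset_biUnion_of_mem id hY)

/-- **`π(X ∩ U₁*) = U₁`** when `π(X) = U₁ ∪ U₂`. [cite: AdamsBuchholzKoteckyMuller2019, Lemma 6.4 (5) (proof: π(X_i) = U_i)] -/
theorem reblock_piecesOf (hMst : M = s * t) (hs : Odd s) (ht : Odd t) (hL : Odd L)
    (hrr : r ≤ r') (hr : r + (2 ^ d - 1) * s ≤ r') (hD : 2 * r' + 2 ≤ D) (hsep : Separated D U₁ U₂)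
    (hU₁ : IsPolymer (L * s) U₁) (hU₂ : IsPolymer (L * s) U₂) {X : Finset (Fin d → ZMod M)}
    (hπ : reblock s (L * s) X = U₁ ∪ U₂) : reblock s (L * s) (piecesOf r' U₁ X) = U₁ := by
  have hπ' : reblock s (L * s) X ⊆ U₁ ∪ U₂ := hπ.le
  -- `π(X₁) ⊆ closure(U₁*)`, disjoint from `U₂`; `π(X₂)` likewise; and `π(X₁) ∪ π(X₂) = U₁ ∪ U₂`
  have hsplit : reblock s (L * s) X = reblock s (L * s) (piecesOf r' U₁ X) ∪ reblock s (L * s) (piecesOf r' U₂ X) := by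
    conv_lhs => rw [← piecesOf_union hMst hs ht hL hrr hr hD hsep hπ']
    exact reblock_union_of_separated s (L * s) ((separated_piecesOf hsep X X).of_le (by omega))
  have h1 : Disjoint (reblock s (L * s) (piecesOf r' U₁ X)) U₂ :=
    disjoint_of_subset_left ((reblock_subset_closure s (L * s) _).trans
      (closure_mono _ (piecesOf_subset_thicken _ _ _)))
      (closure_thicken_disjoint (by omega) hU₂ hsep)
  have h2 : Disjoint (reblock s (L * s) (piecesOf r' U₂ X)) U₁ :=
    disjoint_of_subset_left ((reblock_subset_closure s (L * s) _).trans
      (closure_mono _ (piecesOf_subset_thicken _ _ _)))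
      (closure_thicken_disjoint (by omega) hU₁ hsep.symm)
  have hU12 : Disjoint U₁ U₂ := hsep.disjoint (by omega)
  apply Subset.antisymm
  · intro y hy
    have : y ∈ U₁ ∪ U₂ := by rw [← hπ, hsplit]; exact mem_union_left _ hy
    rcases mem_union.1 this with h | h
    · exact h
    · exact absurd h (Finset.disjoint_left.1 h1 hy)
  · intro y hy
    have : y ∈ reblock s (L * s) X := by rw [hπ]; exact mem_union_left _ hy
    rw [hsplit] at this
    rcases mem_union.1 this with h | h
    · exact h
    · exact absurd hy (Finset.disjoint_left.1 h2 h)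

/-- **Converse**: if `π(X₁) = U₁` and `π(X₂) = U₂` for `k`-polymers `X₁, X₂` then
`π(X₁ ∪ X₂) = U₁ ∪ U₂`. [cite: AdamsBuchholzKoteckyMuller2019, Lemma 6.4 (5) (proof, uniqueness)] -/
theorem reblock_union_eq (hMst : M = s * t) (hs : Odd s) (ht : Odd t) (hL : Odd L)
    (hrr : r ≤ r') (hr : r + (2 ^ d - 1) * s ≤ r') (hD : 2 * r' + 2 ≤ D) (hsep : Separated D U₁ U₂)
    {X₁ X₂ : Finset (Fin d → ZMod M)}
    (h₁ : reblock s (L * s) X₁ = U₁) (h₂ : reblock s (L * s) X₂ = U₂) :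
    reblock s (L * s) (X₁ ∪ X₂) = U₁ ∪ U₂ := by
  have hX₁U : X₁ ⊆ thicken r' U₁ := by
    rw [← h₁]; exact (subset_thicken r _).trans (thicken_subset_thicken_reblock hMst hs ht hL hrr hr X₁)
  have hX₂U : X₂ ⊆ thicken r' U₂ := by
    rw [← h₂]; exact (subset_thicken r _).trans (thicken_subset_thicken_reblock hMst hs ht hL hrr hr X₂)
  have hsepX : Separated 2 X₁ X₂ :=
    (separated_thicken_of_separated hD hsep).mono hX₁U hX₂U
  rw [reblock_union_of_separated s (L * s) hsepX, h₁, h₂]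

/-- The left piece of `X₁ ∪ X₂` is `X₁` (when `π(X_i) = U_i`).
[cite: AdamsBuchholzKoteckyMuller2019, Lemma 6.4 (5) (proof, uniqueness)] -/
theorem piecesOf_union_left (hMst : M = s * t) (hs : Odd s) (ht : Odd t) (hL : Odd L)
    (hrr : r ≤ r') (hr : r + (2 ^ d - 1) * s ≤ r') (hD : 2 * r' + 2 ≤ D) (hsep : Separated D U₁ U₂)
    {X₁ X₂ : Finset (Fin d → ZMod M)}
    (h₁ : reblock s (L * s) X₁ = U₁) (h₂ : reblock s (L * s) X₂ = U₂) :
    piecesOf r' U₁ (X₁ ∪ X₂) = X₁ := by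
  have hX₁U : X₁ ⊆ thicken r' U₁ := by
    rw [← h₁]; exact (subset_thicken r _).trans (thicken_subset_thicken_reblock hMst hs ht hL hrr hr X₁)
  have hX₂U : X₂ ⊆ thicken r' U₂ := by
    rw [← h₂]; exact (subset_thicken r _).trans (thicken_subset_thicken_reblock hMst hs ht hL hrr hr X₂)
  have hdis := (separated_thicken_of_separated hD hsep).disjoint (by norm_num)
  ext y
  rw [piecesOf, mem_inter, mem_union]
  constructor
  · rintro ⟨h | h, hy⟩
    · exact h
    · exact absurd (hX₂U h) (Finset.disjoint_left.1 hdis hy)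
  · exact fun h => ⟨Or.inl h, hX₁U h⟩

/-- The right piece of `X₁ ∪ X₂` is `X₂` (when `π(X_i) = U_i`).
[cite: AdamsBuchholzKoteckyMuller2019, Lemma 6.4 (5) (proof, uniqueness)] -/
theorem piecesOf_union_right (hMst : M = s * t) (hs : Odd s) (ht : Odd t) (hL : Odd L)
    (hrr : r ≤ r') (hr : r + (2 ^ d - 1) * s ≤ r') (hD : 2 * r' + 2 ≤ D) (hsep : Separated D U₁ U₂)
    {X₁ X₂ : Finset (Fin d → ZMod M)}
    (h₁ : reblock s (L * s) X₁ = U₁) (h₂ : reblock s (L * s) X₂ = U₂) :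
    piecesOf r' U₂ (X₁ ∪ X₂) = X₂ := by
  rw [union_comm]
  exact piecesOf_union_left hMst hs ht hL hrr hr hD hsep.symm h₂ h₁

/-- **The sum over `{X ∈ 𝓟_k : π(X) = U₁ ∪ U₂}` is the double sum over
`{X₁ : π(X₁) = U₁} × {X₂ : π(X₂) = U₂}` of the summand at `X₁ ∪ X₂`** — the bijection behind the
factorisation of (6.34) over strictly disjoint `U₁, U₂`.
[cite: AdamsBuchholzKoteckyMuller2019, Lemma 6.4 (5) (proof, last display)] -/
theorem sum_reblock_eq_union (hMst : M = s * t) (hs : Odd s) (ht : Odd t) (hL : Odd L)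
    (hrr : r ≤ r') (hr : r + (2 ^ d - 1) * s ≤ r') (hD : 2 * r' + 2 ≤ D) (hsep : Separated D U₁ U₂)
    (hU₁ : IsPolymer (L * s) U₁) (hU₂ : IsPolymer (L * s) U₂)
    {A : Type*} [AddCommMonoid A] (f : Finset (Fin d → ZMod M) → A) :
    ∑ X ∈ (polys s univ).filter (fun X => reblock s (L * s) X = U₁ ∪ U₂), f X
      = ∑ X₁ ∈ (polys s univ).filter (fun X => reblock s (L * s) X = U₁),
          ∑ X₂ ∈ (polys s univ).filter (fun X => reblock s (L * s) X = U₂), f (X₁ ∪ X₂) := by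
  rw [← Finset.sum_product' (f := fun X₁ X₂ => f (X₁ ∪ X₂))]
  symm
  refine Finset.sum_nbij' (fun p => p.1 ∪ p.2) (fun X => (piecesOf r' U₁ X, piecesOf r' U₂ X)) ?_ ?_ ?_ ?_ ?_
  · rintro ⟨X₁, X₂⟩ hp
    rw [Finset.mem_product] at hp
    obtain ⟨h1, h2⟩ := hp
    obtain ⟨hX₁, hπ₁⟩ := mem_filter.1 h1
    obtain ⟨hX₂, hπ₂⟩ := mem_filter.1 h2
    refine mem_filter.2 ⟨mem_polys.2 ⟨subset_univ _, (mem_polys.1 hX₁).2.union (mem_polys.1 hX₂).2⟩, ?_⟩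
    exact reblock_union_eq hMst hs ht hL hrr hr hD hsep hπ₁ hπ₂
  · intro X hX
    obtain ⟨hXp, hπ⟩ := mem_filter.1 hX
    have hXp' := (mem_polys.1 hXp).2
    rw [Finset.mem_product]
    refine ⟨mem_filter.2 ⟨mem_polys.2 ⟨subset_univ _, ?_⟩, ?_⟩, mem_filter.2 ⟨mem_polys.2 ⟨subset_univ _, ?_⟩, ?_⟩⟩
    · exact isPolymer_piecesOf hMst hs ht hL hrr hr hD hsep hXp' hπ.le
    · exact reblock_piecesOf hMst hs ht hL hrr hr hD hsep hU₁ hU₂ hπ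
    · exact isPolymer_piecesOf hMst hs ht hL hrr hr hD hsep.symm hXp' (by rw [union_comm]; exact hπ.le)
    · exact reblock_piecesOf hMst hs ht hL hrr hr hD hsep.symm hU₂ hU₁ (by rw [union_comm]; exact hπ)
  · rintro ⟨X₁, X₂⟩ hp
    rw [Finset.mem_product] at hp
    obtain ⟨h1, h2⟩ := hp
    obtain ⟨-, hπ₁⟩ := mem_filter.1 h1
    obtain ⟨-, hπ₂⟩ := mem_filter.1 h2
    simp only [piecesOf_union_left hMst hs ht hL hrr hr hD hsep hπ₁ hπ₂,
      piecesOf_union_right hMst hs ht hL hrr hr hD hsep hπ₁ hπ₂]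
  · intro X hX
    obtain ⟨hXp, hπ⟩ := mem_filter.1 hX
    exact piecesOf_union hMst hs ht hL hrr hr hD hsep hπ.le
  · intro X hX; rfl

end Decomposition

end Literature.MathematicalPhysics.StatisticalMechanics.TorusPolymer

end
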